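import Mathlib
import HarnessLib
import Literature.MathematicalPhysics.QuantumLattice.ShellGeometryStability
import Literature.MathematicalPhysics.QuantumLattice.SymmetricRegimeCertificate

/-!
# Crux `WcbcsBcsConstruction` (stmt-HubbardSuperconductivity-2010), line `ladder-scale-certified-chain`:
# stub (R0) `stub_ladderShellGeometry` — shell geometry of the ladder-scale record on the window

The v3 certificate `symmetricRegimeCertificateT U ν (ladderScaleData s hs) ladderTolerance K Λ L₀` of stub (R) has, besides
its thermodynamic block, the continuum SHELL-GEOMETRY conjunct `ShellGeometry (renormalisedBandC ν K) Λ (1/2) 4 (1/25) 3 (1/2)`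
(squared Fermi speed in `[1/4,16]`, level-line curvature in `[1/25,3]`, distance `≥ 1/2` from the van Hove points, on the
whole continuum shell `{p ∈ [-π,π]² : |e_K(p)| ≤ Λ}`). This file PROVES it for every `ν ∈ [-9/10,-3/10]` (⊃ the line's
Grassmann window), every scale `Λ ≤ 1/50` and every frame with `K.coeffNorm 2 ≤ 1/500` — in fact for every
`(1+m+n)²`-summable coefficient table of weight `≤ 1/500` (`shellGeometry_band_of_small_table`; frame form
`shellGeometry_renormalisedBandC_ladderWindow`; registered signature `stub_ladderShellGeometry`). Method: the jets of the
band are those of `ShellGeometryStability.lean`; on the shell `S = cos p₁ + cos p₂ ∈ [0.139, 0.461]` and, with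
`P = cos p₁ cos p₂ ∈ [S-1, S²/4]`, the bare jets are `|∇e|² = 4(2 - S² + 2P)`, curvature numerator `8S(1-P) ≤ 2|∇e|²`; the
frame moves them by `≤ 1/50`, `≤ 2/25`; curvature bounds are taken in squared form; the van Hove distance uses
`1 - x²/2 ≤ cos x`. References: Feldman–Salmhofer–Trubowitz, J. Stat. Phys. 84 (1996) §1; Feldman–Knörrer–Trubowitz,
CMP 247 (2004) §1.
-/

noncomputable section

-- the tree's namespace `Summit.<Summit>.<Problem>.Theorems` repeats the summit name by design (D-0017)
set_option linter.dupNamespace false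

namespace Summit.HubbardSuperconductivity.HubbardSuperconductivity.Theorems

open Literature.MathematicalPhysics.QuantumLattice Literature.Probability.LatticeModels TrigPolyC4v Finset
open scoped BigOperators

/-! ### Weighted series against bounded families -/

/-- `|Σ' c q φ q| ≤ Σ' (1+q₁+q₂)² |c q|` for a family bounded by the weight. [folklore] -/
theorem abs_tsum_mul_le_weight {c : ℕ × ℕ → ℝ}
    (hc : Summable fun q : ℕ × ℕ => ((1 : ℝ) + q.1 + q.2) ^ 2 * |c q|) {φ : ℕ × ℕ → ℝ}
    (hb : ∀ q, |φ q| ≤ ((1 : ℝ) + q.1 + q.2) ^ 2) :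
    |∑' q, c q * φ q| ≤ ∑' q : ℕ × ℕ, ((1 : ℝ) + q.1 + q.2) ^ 2 * |c q| := by
  have h0 : Summable fun q : ℕ × ℕ => ((1 : ℝ) + q.1 + q.2) ^ 2 * |(fun _ : ℕ × ℕ => (0 : ℝ)) q| := by
    simp
  have h := abs_tsum_mul_sub_le_weight hc h0 hb
  simpa [zero_mul, tsum_zero, sub_zero] using h

/-! ### Elementary perturbation bounds (frame jets of size `≤ 1/500`) -/

/-- `|a² - 4sa| ≤ 1/100` for `|s| ≤ 1`, `|a| ≤ 1/500`. [folklore] -/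
theorem abs_sq_sub_four_mul_le {s a : ℝ} (hs : |s| ≤ 1) (ha : |a| ≤ 1 / 500) :
    |a ^ 2 - 4 * s * a| ≤ 1 / 100 := by
  have h1 : |a ^ 2| ≤ 1 / 500 * (1 / 500) := by
    rw [abs_pow, pow_two]
    exact mul_le_mul ha ha (abs_nonneg _) (by norm_num)
  have h2 : |4 * s * a| ≤ 4 * 1 * (1 / 500) := by
    rw [abs_mul, abs_mul]
    have : |(4 : ℝ)| = 4 := abs_of_pos (by norm_num)
    rw [this]
    exact mul_le_mul (mul_le_mul_of_nonneg_left hs (by norm_num)) ha (abs_nonneg _) (by norm_num)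
  calc |a ^ 2 - 4 * s * a| ≤ |a ^ 2| + |4 * s * a| := abs_sub _ _
    _ ≤ 1 / 500 * (1 / 500) + 4 * 1 * (1 / 500) := add_le_add h1 h2
    _ ≤ 1 / 100 := by norm_num

/-- `|2s - a| ≤ 2 + 1/500` for `|s| ≤ 1`, `|a| ≤ 1/500`. [folklore] -/
theorem abs_two_mul_sub_le {s a : ℝ} (hs : |s| ≤ 1) (ha : |a| ≤ 1 / 500) :
    |2 * s - a| ≤ 2 + 1 / 500 := by
  calc |2 * s - a| ≤ |2 * s| + |a| := abs_sub _ _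
    _ ≤ 2 + 1 / 500 := by
        rw [abs_mul, abs_two]
        exact add_le_add (by linarith [mul_le_mul_of_nonneg_left hs (by norm_num : (0:ℝ) ≤ 2)]) ha

/-- The diagonal perturbation of the curvature numerator: `|(2C - b)(2s - a)² - 8Cs²| ≤ 3/100` for
`|C|, |s| ≤ 1`, `|a|, |b| ≤ 1/500`. [folklore] -/
theorem abs_diag_pert_le {C s a b : ℝ} (hC : |C| ≤ 1) (hs : |s| ≤ 1) (ha : |a| ≤ 1 / 500)
    (hb : |b| ≤ 1 / 500) : |(2 * C - b) * (2 * s - a) ^ 2 - 8 * C * s ^ 2| ≤ 3 / 100 := by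
  have hrw : (2 * C - b) * (2 * s - a) ^ 2 - 8 * C * s ^ 2 =
      2 * C * (a ^ 2 - 4 * s * a) - b * (2 * s - a) ^ 2 := by ring
  rw [hrw]
  have h1 : |2 * C * (a ^ 2 - 4 * s * a)| ≤ 2 * 1 * (1 / 100) := by
    rw [abs_mul, abs_mul, abs_two]
    exact mul_le_mul (mul_le_mul_of_nonneg_left hC (by norm_num)) (abs_sq_sub_four_mul_le hs ha)
      (abs_nonneg _) (by norm_num)
  have h2 : |b * (2 * s - a) ^ 2| ≤ 1 / 500 * (2 + 1 / 500) ^ 2 := by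
    rw [abs_mul, abs_pow]
    refine mul_le_mul hb ?_ (by positivity) (by norm_num)
    exact pow_le_pow_left₀ (abs_nonneg _) (abs_two_mul_sub_le hs ha) 2
  calc |2 * C * (a ^ 2 - 4 * s * a) - b * (2 * s - a) ^ 2|
      ≤ |2 * C * (a ^ 2 - 4 * s * a)| + |b * (2 * s - a) ^ 2| := abs_sub _ _
    _ ≤ 2 * 1 * (1 / 100) + 1 / 500 * (2 + 1 / 500) ^ 2 := add_le_add h1 h2
    _ ≤ 3 / 100 := by norm_num

/-- The mixed perturbation of the curvature numerator: `|2(0 - b)(2s₀ - a₀)(2s₁ - a₁)| ≤ 1/50`.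
[folklore] -/
theorem abs_mixed_pert_le {s₀ s₁ a₀ a₁ b : ℝ} (hs₀ : |s₀| ≤ 1) (hs₁ : |s₁| ≤ 1) (ha₀ : |a₀| ≤ 1 / 500)
    (ha₁ : |a₁| ≤ 1 / 500) (hb : |b| ≤ 1 / 500) :
    |2 * (0 - b) * (2 * s₀ - a₀) * (2 * s₁ - a₁)| ≤ 1 / 50 := by
  rw [abs_mul, abs_mul, abs_mul, abs_two, zero_sub, abs_neg]
  calc 2 * |b| * |2 * s₀ - a₀| * |2 * s₁ - a₁|
      ≤ 2 * (1 / 500) * (2 + 1 / 500) * (2 + 1 / 500) := by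
        have e0 := abs_two_mul_sub_le hs₀ ha₀
        have e1 := abs_two_mul_sub_le hs₁ ha₁
        have := abs_nonneg b
        have := abs_nonneg (2 * s₀ - a₀)
        have := abs_nonneg (2 * s₁ - a₁)
        gcongr
    _ ≤ 1 / 50 := by norm_num

/-! ### The algebraic core: speed and curvature numerals on the window -/

/-- **Jet bounds on the shell.** For `s₀² + C₀² = s₁² + C₁² = 1`, `S = C₀ + C₁ ∈ [139/1000, 461/1000]` and
frame jets `a₀, a₁, b₀₀, b₀₁, b₁₁` of size `≤ 1/500` (`S ∈ [139/1000, 461/1000]`), the squared speed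
`G = (2s₀ - a₀)² + (2s₁ - a₁)²` and the curvature numerator
`N = (2C₀ - b₀₀)(2s₁ - a₁)² - 2(0 - b₀₁)(2s₀ - a₀)(2s₁ - a₁) + (2C₁ - b₁₁)(2s₀ - a₀)²` satisfy
`1/4 ≤ G ≤ 16`, `0 < N`, `N² ≤ 9 G³`, `G³ ≤ 625 N²`. [folklore] -/
theorem shell_jet_bounds {C₀ C₁ s₀ s₁ a₀ a₁ b₀₀ b₀₁ b₁₁ G N : ℝ}
    (h0 : s₀ ^ 2 + C₀ ^ 2 = 1) (h1 : s₁ ^ 2 + C₁ ^ 2 = 1)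
    (hSlo : (139 : ℝ) / 1000 ≤ C₀ + C₁) (hShi : C₀ + C₁ ≤ (461 : ℝ) / 1000)
    (ha₀ : |a₀| ≤ 1 / 500) (ha₁ : |a₁| ≤ 1 / 500) (hb₀₀ : |b₀₀| ≤ 1 / 500) (hb₀₁ : |b₀₁| ≤ 1 / 500)
    (hb₁₁ : |b₁₁| ≤ 1 / 500)
    (hG : G = (2 * s₀ - a₀) ^ 2 + (2 * s₁ - a₁) ^ 2)
    (hN : N = (2 * C₀ - b₀₀) * (2 * s₁ - a₁) ^ 2 - 2 * (0 - b₀₁) * (2 * s₀ - a₀) * (2 * s₁ - a₁) +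
      (2 * C₁ - b₁₁) * (2 * s₀ - a₀) ^ 2) :
    (1 / 2 : ℝ) ^ 2 ≤ G ∧ G ≤ (4 : ℝ) ^ 2 ∧ 0 < G ∧ 0 < N ∧ N ^ 2 ≤ 9 * G ^ 3 ∧ G ^ 3 ≤ 625 * N ^ 2 := by
  -- unit bounds
  have hC₀ : |C₀| ≤ 1 := by
    rw [← sq_le_one_iff_abs_le_one]; nlinarith [sq_nonneg s₀]
  have hC₁ : |C₁| ≤ 1 := by
    rw [← sq_le_one_iff_abs_le_one]; nlinarith [sq_nonneg s₁]
  have hs₀ : |s₀| ≤ 1 := by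
    rw [← sq_le_one_iff_abs_le_one]; nlinarith [sq_nonneg C₀]
  have hs₁ : |s₁| ≤ 1 := by
    rw [← sq_le_one_iff_abs_le_one]; nlinarith [sq_nonneg C₁]
  have hC₀' := abs_le.1 hC₀
  have hC₁' := abs_le.1 hC₁
  -- the bare jets
  set S := C₀ + C₁ with hS
  set G₀ := 4 * (s₀ ^ 2 + s₁ ^ 2) with hG₀
  set N₀ := 8 * (C₀ * s₁ ^ 2 + C₁ * s₀ ^ 2) with hN₀
  have hG₀eq : G₀ = 4 * (2 - S ^ 2 + 2 * (C₀ * C₁)) := by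
    rw [hG₀, hS]; linear_combination 4 * h0 + 4 * h1
  have hN₀eq : N₀ = 8 * S * (1 - C₀ * C₁) := by
    rw [hN₀, hS]
    have e0 : s₀ ^ 2 = 1 - C₀ ^ 2 := by linarith
    have e1 : s₁ ^ 2 = 1 - C₁ ^ 2 := by linarith
    rw [e0, e1]; ring
  have hQ : 0 ≤ (1 - C₀) * (1 - C₁) := mul_nonneg (by linarith [hC₀'.2]) (by linarith [hC₁'.2])
  have hQeq : (1 - C₀) * (1 - C₁) = 1 - S + C₀ * C₁ := by rw [hS]; ring
  have hPlo : S - 1 ≤ C₀ * C₁ := by linarith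
  have hPhi : C₀ * C₁ ≤ S ^ 2 / 4 := by
    have : S ^ 2 - 4 * (C₀ * C₁) = (C₀ - C₁) ^ 2 := by rw [hS]; ring
    nlinarith [sq_nonneg (C₀ - C₁)]
  -- G₀ ∈ [1.0347, 8]
  have hG₀lo : (258679 : ℝ) / 250000 ≤ G₀ := by
    have hwin : 0 ≤ (S - 139 / 1000) * (1861 / 1000 - S) := mul_nonneg (by linarith) (by linarith)
    have hwin' : (S - 139 / 1000) * (1861 / 1000 - S) = -S ^ 2 + 2 * S - 258679 / 1000000 := by ring
    rw [hG₀eq]; linarith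
  have hG₀hi : G₀ ≤ 8 := by
    rw [hG₀]; linarith [sq_nonneg C₀, sq_nonneg C₁]
  -- N₀ ∈ [1.05, 2 G₀]
  have hSpos : 0 ≤ S := by linarith
  have hN₀lo : (21 : ℝ) / 20 ≤ N₀ := by
    have h3 : 8 * S * (C₀ * C₁) ≤ 8 * S * (S ^ 2 / 4) := mul_le_mul_of_nonneg_left hPhi (by linarith)
    have h4 : S ^ 2 ≤ (461 / 1000 : ℝ) ^ 2 := pow_le_pow_left₀ hSpos hShi 2
    have h5 : S * S ^ 2 ≤ S * (461 / 1000 : ℝ) ^ 2 := mul_le_mul_of_nonneg_left h4 hSpos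
    have h6 : 8 * S * (S ^ 2 / 4) = 2 * (S * S ^ 2) := by ring
    have h7 : 8 * S * (1 - C₀ * C₁) = 8 * S - 8 * S * (C₀ * C₁) := by ring
    rw [hN₀eq, h7]
    linarith only [h3, h5, h6, hSlo]
  have hN₀hi : N₀ ≤ 2 * G₀ := by
    have e : 2 * G₀ - N₀ = 8 * ((2 + S) * ((1 - C₀) * (1 - C₁))) := by rw [hG₀eq, hN₀eq, hQeq]; ring
    have : 0 ≤ (2 + S) * ((1 - C₀) * (1 - C₁)) := mul_nonneg (by linarith) hQ
    linarith
  -- the perturbations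
  have hGpert : |G - G₀| ≤ 1 / 50 := by
    have e : G - G₀ = (a₀ ^ 2 - 4 * s₀ * a₀) + (a₁ ^ 2 - 4 * s₁ * a₁) := by rw [hG, hG₀]; ring
    rw [e]
    calc |(a₀ ^ 2 - 4 * s₀ * a₀) + (a₁ ^ 2 - 4 * s₁ * a₁)|
        ≤ |a₀ ^ 2 - 4 * s₀ * a₀| + |a₁ ^ 2 - 4 * s₁ * a₁| := abs_add_le _ _
      _ ≤ 1 / 100 + 1 / 100 := add_le_add (abs_sq_sub_four_mul_le hs₀ ha₀) (abs_sq_sub_four_mul_le hs₁ ha₁)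
      _ = 1 / 50 := by norm_num
  have hNpert : |N - N₀| ≤ 2 / 25 := by
    have e : N - N₀ = ((2 * C₀ - b₀₀) * (2 * s₁ - a₁) ^ 2 - 8 * C₀ * s₁ ^ 2) +
        (-(2 * (0 - b₀₁) * (2 * s₀ - a₀) * (2 * s₁ - a₁))) +
        ((2 * C₁ - b₁₁) * (2 * s₀ - a₀) ^ 2 - 8 * C₁ * s₀ ^ 2) := by rw [hN, hN₀]; ring
    rw [e]
    calc _ ≤ |((2 * C₀ - b₀₀) * (2 * s₁ - a₁) ^ 2 - 8 * C₀ * s₁ ^ 2) +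
          (-(2 * (0 - b₀₁) * (2 * s₀ - a₀) * (2 * s₁ - a₁)))| +
          |(2 * C₁ - b₁₁) * (2 * s₀ - a₀) ^ 2 - 8 * C₁ * s₀ ^ 2| := abs_add_le _ _
      _ ≤ (|(2 * C₀ - b₀₀) * (2 * s₁ - a₁) ^ 2 - 8 * C₀ * s₁ ^ 2| +
          |(-(2 * (0 - b₀₁) * (2 * s₀ - a₀) * (2 * s₁ - a₁)))|) +
          |(2 * C₁ - b₁₁) * (2 * s₀ - a₀) ^ 2 - 8 * C₁ * s₀ ^ 2| :=
          add_le_add (abs_add_le _ _) le_rfl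
      _ ≤ (3 / 100 + 1 / 50) + 3 / 100 := by
          refine add_le_add (add_le_add (abs_diag_pert_le hC₀ hs₁ ha₁ hb₀₀) ?_)
            (abs_diag_pert_le hC₁ hs₀ ha₀ hb₁₁)
          rw [abs_neg]
          exact abs_mixed_pert_le hs₀ hs₁ ha₀ ha₁ hb₀₁
      _ = 2 / 25 := by norm_num
  have hGp := abs_le.1 hGpert
  have hNp := abs_le.1 hNpert
  -- consequences
  have hGlo : (1 : ℝ) ≤ G := by linarith
  have hGhi : G ≤ 401 / 50 := by linarith
  have hNlo : (97 : ℝ) / 100 ≤ N := by linarith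
  have hNhi : N ≤ 2 * G + 3 / 25 := by linarith
  have hGpos : 0 < G := by linarith
  have hNpos : 0 < N := by linarith
  refine ⟨by linarith, by linarith, hGpos, hNpos, ?_, ?_⟩
  · -- N² ≤ (2G + 3/25)² ≤ 9 G³ on G ≥ 1
    have hsq : N ^ 2 ≤ (2 * G + 3 / 25) ^ 2 := pow_le_pow_left₀ hNpos.le hNhi 2
    have hsq' : (2 * G + 3 / 25) ^ 2 = 4 * G ^ 2 + 12 / 25 * G + 9 / 625 := by ring
    have hG1 : (1 : ℝ) * G ≤ G ^ 2 := by
      have : G ^ 2 = G * G := by ring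
      rw [this]; exact mul_le_mul_of_nonneg_right hGlo hGpos.le
    have hG2 : (1 : ℝ) * G ^ 2 ≤ G ^ 3 := by
      have : G ^ 3 = G * G ^ 2 := by ring
      rw [this]; exact mul_le_mul_of_nonneg_right hGlo (sq_nonneg G)
    linarith only [hsq, hsq', hG1, hG2, hGlo]
  · -- G³ ≤ (401/50)³ ≤ 625 (97/100)² ≤ 625 N²
    have hG3 : G ^ 3 ≤ (401 / 50 : ℝ) ^ 3 := pow_le_pow_left₀ hGpos.le hGhi 3
    have hN2 : ((97 : ℝ) / 100) ^ 2 ≤ N ^ 2 := pow_le_pow_left₀ (by norm_num) hNlo 2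
    linarith only [hG3, hN2]

/-- From the squared forms to the curvature bounds: if `0 < G`, `0 < N`, `N² ≤ 9G³` and `G³ ≤ 625N²`
then `1/25 ≤ |N / G^{3/2}| ≤ 3`. [folklore] -/
theorem curvature_bounds_of_sq {G N : ℝ} (hG : 0 < G) (hN : 0 < N) (h1 : N ^ 2 ≤ 9 * G ^ 3)
    (h2 : G ^ 3 ≤ 625 * N ^ 2) :
    (1 / 25 : ℝ) ≤ |N / G ^ ((3 : ℝ) / 2)| ∧ |N / G ^ ((3 : ℝ) / 2)| ≤ 3 := by
  have hpow : G ^ ((3 : ℝ) / 2) = G * Real.sqrt G := by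
    rw [show (3 : ℝ) / 2 = 1 + 1 / 2 by norm_num, Real.rpow_add hG, Real.rpow_one, Real.sqrt_eq_rpow]
  have hsqrt : 0 < Real.sqrt G := Real.sqrt_pos.2 hG
  have hden : 0 < G * Real.sqrt G := mul_pos hG hsqrt
  have hsq : Real.sqrt G ^ 2 = G := Real.sq_sqrt hG.le
  rw [hpow, abs_of_pos (div_pos hN hden)]
  constructor
  · rw [le_div_iff₀ hden]
    -- (G √G)² = G³ ≤ 625 N² = (25 N)²
    have hle : G * Real.sqrt G ≤ 25 * N := by
      rw [← sq_le_sq₀ hden.le (by linarith)]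
      calc (G * Real.sqrt G) ^ 2 = G ^ 3 := by rw [mul_pow, hsq]; ring
        _ ≤ 625 * N ^ 2 := h2
        _ = (25 * N) ^ 2 := by ring
    linarith
  · rw [div_le_iff₀ hden]
    rw [← sq_le_sq₀ hN.le (by positivity)]
    calc N ^ 2 ≤ 9 * G ^ 3 := h1
      _ = (3 * (G * Real.sqrt G)) ^ 2 := by rw [mul_pow, mul_pow, hsq]; ring

/-! ### The van Hove distance -/

/-- Near a van Hove point the level sum `cos p₁ + cos p₂` is below `1/8`: if
`(p₁ - v₁)² + (p₂ - v₂)² < 1/4` for `v ∈ {(±π,0),(0,±π)}` then `cos p₁ + cos p₂ < 1/8`. Hence on the shells of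
the window (where the sum is at least `139/1000 > 1/8`) the distance to the van Hove points is at least `1/2`.
[folklore] -/
theorem vanHove_dist_of_level {p : Fin 2 → ℝ} (hS : (139 : ℝ) / 1000 ≤ Real.cos (p 0) + Real.cos (p 1)) :
    ∀ v ∈ vanHovePoints, (1 / 2 : ℝ) ^ 2 ≤ (p 0 - v 0) ^ 2 + (p 1 - v 1) ^ 2 := by
  -- the one-variable fact: `(x - π)² < 1/4 ⇒ cos x < -7/8`, and the same at `-π`
  have key : ∀ x t : ℝ, (x - t) ^ 2 < 1 / 4 → Real.cos t = -1 → Real.cos x < -(7 : ℝ) / 8 := by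
    intro x t hxt ht
    have hc : Real.cos x = -Real.cos (x - t) := by
      have : x = (x - t) + t := by ring
      conv_lhs => rw [this, Real.cos_add, ht]
      have hs : Real.sin t = 0 := by
        have := Real.sin_sq_add_cos_sq t
        rw [ht] at this
        nlinarith [sq_nonneg (Real.sin t)]
      rw [hs]; ring
    have hlow := Real.one_sub_sq_div_two_le_cos (x := x - t)
    rw [hc]
    nlinarith
  have hcos1 : ∀ x : ℝ, Real.cos x ≤ 1 := Real.cos_le_one
  intro v hv
  by_contra hlt
  push Not at hlt
  simp only [vanHovePoints, List.mem_cons, List.not_mem_nil, or_false] at hv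
  have hπ : Real.cos Real.pi = -1 := Real.cos_pi
  have hnπ : Real.cos (-Real.pi) = -1 := by rw [Real.cos_neg, Real.cos_pi]
  rcases hv with rfl | rfl | rfl | rfl
  · simp only [Matrix.cons_val_zero, Matrix.cons_val_one] at hlt
    have h0 : (p 0 - Real.pi) ^ 2 < 1 / 4 := by nlinarith [sq_nonneg (p 1 - 0)]
    have := key (p 0) Real.pi h0 hπ
    linarith [hcos1 (p 1)]
  · simp only [Matrix.cons_val_zero, Matrix.cons_val_one] at hlt
    have h0 : (p 0 - -Real.pi) ^ 2 < 1 / 4 := by nlinarith [sq_nonneg (p 1 - 0)]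
    have := key (p 0) (-Real.pi) h0 hnπ
    linarith [hcos1 (p 1)]
  · simp only [Matrix.cons_val_zero, Matrix.cons_val_one] at hlt
    have h0 : (p 1 - Real.pi) ^ 2 < 1 / 4 := by nlinarith [sq_nonneg (p 0 - 0)]
    have := key (p 1) Real.pi h0 hπ
    linarith [hcos1 (p 0)]
  · simp only [Matrix.cons_val_zero, Matrix.cons_val_one] at hlt
    have h0 : (p 1 - -Real.pi) ^ 2 < 1 / 4 := by nlinarith [sq_nonneg (p 0 - 0)]
    have := key (p 1) (-Real.pi) h0 hnπ
    linarith [hcos1 (p 0)]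

/-! ### The shell geometry of a countertermed band with a small `C²` table -/

/-- **Shell geometry of the ladder-scale record on the Grassmann window (table form).** For every chemical
potential `ν ∈ [-9/10, -3/10]`, every coefficient table `c` with `Σ (1+m+n)² |c_{mn}| ≤ 1/500` and every scale
`Λ ≤ 1/50`, the continuum band `e(p) = -2(cos p₁ + cos p₂) - ν - Σ' c_{mn} h_{mn}(p)` has, on the whole shell
`{p ∈ [-π,π]² : |e(p)| ≤ Λ}`: squared Fermi speed in `[1/4, 16]`, level-line curvature in `[1/25, 3]` in
absolute value, and Euclidean distance at least `1/2` from the van Hove points — i.e.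
`ShellGeometry e Λ (1/2) 4 (1/25) 3 (1/2)`, the geometric numerals of `ladderScaleData`.
[cite: FeldmanKnorrerTrubowitz2004, §1] -/
theorem shellGeometry_band_of_small_table {ν : ℝ} (hν : ν ∈ Set.Icc (-(9 : ℝ) / 10) (-(3 : ℝ) / 10))
    {c : ℕ × ℕ → ℝ} (hc : Summable fun q : ℕ × ℕ => ((1 : ℝ) + q.1 + q.2) ^ 2 * |c q|)
    (hη : ∑' q : ℕ × ℕ, ((1 : ℝ) + q.1 + q.2) ^ 2 * |c q| ≤ 1 / 500) {Λ : ℝ} (hΛ : Λ ≤ 1 / 50) :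
    ShellGeometry (fun p : Fin 2 → ℝ => -2 * (Real.cos (p 0) + Real.cos (p 1)) - ν -
        ∑' q : ℕ × ℕ, c q * harmonic q.1 q.2 p) Λ (1 / 2) 4 (1 / 25) 3 (1 / 2) := by
  intro p _ hpΛ
  -- the jets of the band in evaluated form
  have he := fun p v => (fderiv_band ν hc p).2 v
  have h₀ := fun p v => (fderiv_bandGrad_fst hc p).2 v
  have h₁ := fun p v => (fderiv_bandGrad_snd hc p).2 v
  have hGeq := gradSq_of_fderiv he p
  have hκeq := levelCurvature_of_fderiv he h₀ h₁ p
  -- names for the frame jets at `p`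
  set a₀ := ∑' q : ℕ × ℕ, c q * harmonicGrad q.1 q.2 p 0 with ha₀def
  set a₁ := ∑' q : ℕ × ℕ, c q * harmonicGrad q.1 q.2 p 1 with ha₁def
  set b₀₀ := ∑' q : ℕ × ℕ, c q * -((((q.1 : ℝ) ^ 2 * Real.cos (q.1 * p 0) * Real.cos (q.2 * p 1) +
      (q.2 : ℝ) ^ 2 * Real.cos (q.2 * p 0) * Real.cos (q.1 * p 1)) / 2)) with hb₀₀def
  set b₀₁ := ∑' q : ℕ × ℕ, c q * ((q.1 : ℝ) * q.2 *
      (Real.sin (q.1 * p 0) * Real.sin (q.2 * p 1) + Real.sin (q.2 * p 0) * Real.sin (q.1 * p 1)) / 2)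
    with hb₀₁def
  set b₁₁ := ∑' q : ℕ × ℕ, c q * -((((q.2 : ℝ) ^ 2 * Real.cos (q.1 * p 0) * Real.cos (q.2 * p 1) +
      (q.1 : ℝ) ^ 2 * Real.cos (q.2 * p 0) * Real.cos (q.1 * p 1)) / 2)) with hb₁₁def
  set k := ∑' q : ℕ × ℕ, c q * harmonic q.1 q.2 p with hkdef
  -- their sizes
  have ha₀ : |a₀| ≤ 1 / 500 :=
    (abs_tsum_mul_le_weight hc fun q => abs_harmonicGrad_le_weight q p 0).trans hη
  have ha₁ : |a₁| ≤ 1 / 500 :=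
    (abs_tsum_mul_le_weight hc fun q => abs_harmonicGrad_le_weight q p 1).trans hη
  have hb₀₀ : |b₀₀| ≤ 1 / 500 := (abs_tsum_mul_le_weight hc fun q => abs_hxx_le_weight q p).trans hη
  have hb₀₁ : |b₀₁| ≤ 1 / 500 := (abs_tsum_mul_le_weight hc fun q => abs_hxy_le_weight q p).trans hη
  have hb₁₁ : |b₁₁| ≤ 1 / 500 := (abs_tsum_mul_le_weight hc fun q => abs_hyy_le_weight q p).trans hη
  have hk : |k| ≤ 1 / 500 := (abs_tsum_mul_le_weight hc fun q => abs_harmonic_le_weight q p).trans hη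
  -- the shell pins the level sum `S = cos p₀ + cos p₁`
  have hshell := abs_le.1 hpΛ
  have hk' := abs_le.1 hk
  have hSlo : (139 : ℝ) / 1000 ≤ Real.cos (p 0) + Real.cos (p 1) := by
    have := hshell.2; simp only at this; linarith [hν.2]
  have hShi : Real.cos (p 0) + Real.cos (p 1) ≤ (461 : ℝ) / 1000 := by
    have := hshell.1; simp only at this; linarith [hν.1]
  -- the algebraic core
  obtain ⟨hG1, hG2, hGpos, hNpos, hN1, hN2⟩ := shell_jet_bounds (Real.sin_sq_add_cos_sq (p 0))
    (Real.sin_sq_add_cos_sq (p 1)) hSlo hShi ha₀ ha₁ hb₀₀ hb₀₁ hb₁₁ rfl rfl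
  refine ⟨?_, ?_, vanHove_dist_of_level hSlo⟩
  · rw [hGeq]; exact ⟨hG1, hG2⟩
  · rw [hκeq]; exact curvature_bounds_of_sq hGpos hNpos hN1 hN2

/-- **Shell geometry of the ladder-scale record on the Grassmann window (frame form).** For every chemical
potential `ν ∈ [-9/10, -3/10]`, every frame `K : TrigPolyC4v` with `C²` coefficient weight
`K.coeffNorm 2 ≤ 1/500` and every scale `Λ ≤ 1/50`:
`ShellGeometry (renormalisedBandC ν K) Λ (1/2) 4 (1/25) 3 (1/2)` — the third conjunct of the v3 certificate
`symmetricRegimeCertificateT U ν (ladderScaleData s hs) ladderTolerance K Λ L₀` of stub (R) of line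
`ladder-scale-certified-chain` (crux `WcbcsBcsConstruction`), for every `s ≤ 1/100`.
[cite: FeldmanKnorrerTrubowitz2004, §1] -/
theorem shellGeometry_renormalisedBandC_ladderWindow {ν : ℝ}
    (hν : ν ∈ Set.Icc (-(9 : ℝ) / 10) (-(3 : ℝ) / 10)) (K : TrigPolyC4v) (hK : K.coeffNorm 2 ≤ 1 / 500)
    {Λ : ℝ} (hΛ : Λ ≤ 1 / 50) :
    ShellGeometry (renormalisedBandC ν K) Λ (1 / 2) 4 (1 / 25) 3 (1 / 2) := by
  -- the zero-extended table of `K`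
  set sq := Finset.range (K.degree + 1) ×ˢ Finset.range (K.degree + 1) with hsq
  obtain ⟨c, hc⟩ : ∃ c : ℕ × ℕ → ℝ, ∀ q, c q = if q ∈ sq then K.coeff q.1 q.2 else 0 := ⟨_, fun _ => rfl⟩
  have hc0 : ∀ q ∉ sq, c q = 0 := fun q hq => by rw [hc, if_neg hq]
  have hsum : Summable fun q : ℕ × ℕ => ((1 : ℝ) + q.1 + q.2) ^ 2 * |c q| :=
    summable_of_ne_finset_zero (s := sq) fun q hq => by rw [hc0 q hq, abs_zero, mul_zero]
  have hη : ∑' q : ℕ × ℕ, ((1 : ℝ) + q.1 + q.2) ^ 2 * |c q| ≤ 1 / 500 := by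
    have : ∑' q : ℕ × ℕ, ((1 : ℝ) + q.1 + q.2) ^ 2 * |c q| = K.coeffNorm 2 := by
      rw [tsum_eq_sum (s := sq) (fun q hq => by rw [hc0 q hq, abs_zero, mul_zero]), TrigPolyC4v.coeffNorm,
        hsq, Finset.sum_product]
      refine Finset.sum_congr rfl fun m hm => Finset.sum_congr rfl fun n hn => ?_
      rw [hc, if_pos (Finset.mem_product.2 ⟨hm, hn⟩)]
    rw [this]; exact hK
  have hband : renormalisedBandC ν K = fun p : Fin 2 → ℝ =>
      -2 * (Real.cos (p 0) + Real.cos (p 1)) - ν - ∑' q : ℕ × ℕ, c q * harmonic q.1 q.2 p := by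
    funext p
    simp only [renormalisedBandC, TrigPolyC4v.eval]
    congr 1
    rw [tsum_eq_sum (s := sq) (fun q hq => by rw [hc0 q hq, zero_mul]), hsq, Finset.sum_product]
    refine Finset.sum_congr rfl fun m hm => Finset.sum_congr rfl fun n hn => ?_
    rw [hc, if_pos (Finset.mem_product.2 ⟨hm, hn⟩)]
  rw [hband]
  exact shellGeometry_band_of_small_table hν hsum hη hΛ

/-- **Stub (R0) `stub_ladderShellGeometry` of line `ladder-scale-certified-chain`** (crux `WcbcsBcsConstruction`,
stmt-HubbardSuperconductivity-2010; registered signature): the shell-geometry conjunct of the ladder-scale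
certificate holds for every chemical potential in `[-9/10, -3/10]`, every frame with `K.coeffNorm 2 ≤ 1/500` and
every scale `Λ ≤ 1/50`, with the numerals `(v₁, v₂, κ₁, κ₂, d) = (1/2, 4, 1/25, 3, 1/2)` of `ladderScaleData`.
[cite: FeldmanKnorrerTrubowitz2004, §1] -/
theorem stub_ladderShellGeometry :
    ∀ ν ∈ Set.Icc (-(9:ℝ) / 10) (-(3:ℝ) / 10), ∀ K : TrigPolyC4v, K.coeffNorm 2 ≤ 1 / 500 →
      ∀ Λ : ℝ, Λ ≤ 1 / 50 → ShellGeometry (renormalisedBandC ν K) Λ (1 / 2) 4 (1 / 25) 3 (1 / 2) :=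
  fun _ hν K hK _ hΛ => shellGeometry_renormalisedBandC_ladderWindow hν K hK hΛ

end Summit.HubbardSuperconductivity.HubbardSuperconductivity.Theorems

end
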